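import Summits.ResolutionOfSingularities.ResolutionOfSingularities.Theorems.EquisingularLiftEquisingularLiftNatSubchainSupplierInvDefs
import Summits.ResolutionOfSingularities.ResolutionOfSingularities.Theorems.EquisingularLiftEquisingularLiftNatCarrierStrictTransformStalks
import HarnessLib

/-!
# [OURS · L1 W4.5(b) · EL♮(3)] HSUB(ReachTC⁺)₃ — `inv_step_singular`, clause (v) over the stepped point: `TCPlus.ConeDeltaRegular c Φ` of
# the centred package IS the regularity (and codimension two) of the quotient stalks `𝒪_{X″,z}/(St 𝓢 ⊔ St K)_z` at every point `z`
# of the new in-carrier surface over `p`, for ANY blow-up of the section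

Crux `EquisingularLiftNat` = stmt-ResolutionOfSingularities-20038 (child EL♮(3) = stmt-ResolutionOfSingularities-20148), route
EquisingularLift, line `sections`; registered stub `stub_elnat_tcPlusPointResolution`, closing on res-L1-w45b-stub-1's HSUB′(ReachTC⁺)₃
assembly (driver p526242, INV DEFS v3 = …NatSubchainSupplierInvDefs p532383, brick `inv_step_singular`: «regularity at the new special
points by (vi)'s Δ-package»). Helper file `--supports stmt-ResolutionOfSingularities-20148 --as helper` by res-D-pv-029 (offer (n1) of
2026-08-27T13:36Z). HONEST FRAMING: OURS (cell res-hironaka, slot W4.5(b)); NOT a statement of any manuscript; AI-written, weaker than expert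
review. No `sorry`; standard axioms.

WHAT. The DEFS file explains `ConeDeltaRegular c Φ` as «regular quotient stalks of `St(𝓢) ⊔ St(K)` over `p` for ANY blow-up of the
section, by p522194». This file is that sentence as a theorem: for a blow-up `τ : X″ → X` along `J` with `J_p = (c)` (the cone-pack
hypotheses of res-L1-w45b-stub-1's `exists_stalk_carrierStrictTransform`, …NatCarrierStrictTransformStalks p522194) and a point `z` over `p`
ON the new surface `V(St 𝓢 ⊔ St K)`, the quotient stalk `𝒪_{X″,z} ⧸ (St 𝓢 ⊔ St K)_z` is a regular local ring and
`dim + 2 = dim 𝒪_{X″,z}` — p522194 presents `𝒪_{X″,z}` as a localisation `B_𝔔` of the chart algebra `B = A[c/c_{j′+1}]` at a prime over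
`𝔪_p` containing `e₀` and `Φ(e′)`, with `(St 𝓢 ⊔ St K)_z = (χ e₀) ⊔ (χ Φ(e′))`; `ConeDeltaRegular` is quantified over exactly such primes
and over every model `S` of `B_𝔔`, and the stalk is one (`isLocalization_stalk_of_ringEquiv`, p509910).

* `isRegularLocalRing_quotient_carrierStrictTransform_of_coneDeltaRegular` — the statement, in Member (v) currency (regularity ∧ codimension two).

References: res-L1-w45b-stub-1 …NatCarrierStrictTransformStalks (p522194), …NatSubchainSupplierInvDefs (p532383); res-type-100
…NatCarrierDeltaStalks (p509910). [cite: StacksProject, Tag 0804]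
-/

set_option linter.dupNamespace false -- mandated namespace `Summit.<Summit>.<Problem>` of this single-conjunct summit

noncomputable section

open CategoryTheory AlgebraicGeometry TopologicalSpace IsLocalRing MvPolynomial
open Literature.AlgebraicGeometry.Resolution
open AlgebraicGeometry.Scheme.IdealSheafData

namespace Summit.ResolutionOfSingularities.ResolutionOfSingularities.Cruxes.EquisingularLiftNat.Sections

variable {X X' : Scheme.{0}} {τ : X' ⟶ X} {J : X.IdealSheafData}

/-- **Clause (v) over the stepped point from the Δ-package.** Blow-up `τ` along `J`, point `x'` with `τ x' ∈ supp J` on the new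
surface `V(St 𝓢 ⊔ St K)`, the cone pack `(c, Φ)` at `τ x'` (p522194's hypotheses) and `TCPlus.ConeDeltaRegular c Φ`. Then
`𝒪_{X′,x'} ⧸ (St 𝓢 ⊔ St K)_{x'}` is a regular local ring and `dim (𝒪_{X′,x'} ⧸ (St 𝓢 ⊔ St K)_{x'}) + 2 = dim 𝒪_{X′,x'}`.
[cite: StacksProject, Tag 0804] [OURS · L1 W4.5b] brick toward `stub_elnat_tcPlusPointResolution` (stmt-ResolutionOfSingularities-20148 /
-20038), Member (v) after `inv_step_singular`; NOT a statement of the manuscript. -/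
theorem isRegularLocalRing_quotient_carrierStrictTransform_of_coneDeltaRegular [IsLocallyNoetherian X'] (hτ : IsBlowup τ J)
    (𝓢 K : X.IdealSheafData) (x' : X') (hx' : τ x' ∈ (J.support : Set X)) {r : ℕ}
    (c : Fin (r + 1) → X.presheaf.stalk (τ x')) (hcJ : Ideal.span (Set.range c) = stalkIdeal J (τ x'))
    (hc : IsQuasiRegular c) [IsDomain (X.presheaf.stalk (τ x') ⧸ Ideal.span (Set.range c))]
    (hcb : IsQuasiRegular fun l : Fin r => Ideal.Quotient.mk (Ideal.span {c 0}) (c l.succ))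
    (h𝓢 : stalkIdeal 𝓢 (τ x') = Ideal.span {c 0})
    {d : ℕ} (Φ : MvPolynomial (Fin r) (X.presheaf.stalk (τ x'))) (hΦd : Φ.IsHomogeneous d)
    (hΦ : MvPolynomial.map (Ideal.Quotient.mk (Ideal.span (Set.range c))) Φ ≠ 0)
    (hK : stalkIdeal K (τ x') = Ideal.span {MvPolynomial.eval (fun l => c l.succ) Φ})
    (hx'D : x' ∈ ((strictTransformIdeal τ J 𝓢 ⊔ strictTransformIdeal τ J K).support : Set X'))
    (hΔ : TCPlus.ConeDeltaRegular c Φ) :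
    IsRegularLocalRing (X'.presheaf.stalk x' ⧸ stalkIdeal (strictTransformIdeal τ J 𝓢 ⊔ strictTransformIdeal τ J K) x') ∧
      ringKrullDim (X'.presheaf.stalk x' ⧸ stalkIdeal (strictTransformIdeal τ J 𝓢 ⊔ strictTransformIdeal τ J K) x') + 2 =
        ringKrullDim (X'.presheaf.stalk x') := by
  classical
  -- `x'` lies on `V(St 𝓢)` (the sum contains `St 𝓢`)
  have hx'S : x' ∈ ((strictTransformIdeal τ J 𝓢).support : Set X') :=
    Scheme.IdealSheafData.support_antitone (le_sup_left : strictTransformIdeal τ J 𝓢 ≤ _) hx'D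
  obtain ⟨j', 𝔔, χ, e, hχ, he, h𝔔, -, hSt𝓢, hStK, -, hiff⟩ :=
    exists_stalk_carrierStrictTransform hτ 𝓢 K x' hx' c hcJ hc hcb h𝓢 Φ hΦd hΦ hK hx'S
  -- the two strict transforms lie in `𝔔`
  have hΦ𝔔 : MvPolynomial.aeval (fun l => blowupAlgebra.frac c j'.succ l.succ) Φ ∈ 𝔔.asIdeal := hiff.mp hx'D
  have he₀ : blowupAlgebra.frac c j'.succ 0 ∈ 𝔔.asIdeal := by
    have h := (mem_support_iff_stalkIdeal_le _ _).mp hx'S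
    rw [hSt𝓢, Ideal.span_singleton_le_iff_mem, mem_maximalIdeal_iff_of_stalk_ringEquiv 𝔔 x' χ e he] at h
    exact h
  -- the stalk is a model of `B_𝔔`
  letI := χ.toAlgebra
  haveI : IsLocalization.AtPrime (X'.presheaf.stalk x') 𝔔.asIdeal := isLocalization_stalk_of_ringEquiv 𝔔 x' χ e he
  have hId : stalkIdeal (strictTransformIdeal τ J 𝓢 ⊔ strictTransformIdeal τ J K) x' =
      Ideal.span {algebraMap _ (X'.presheaf.stalk x') (blowupAlgebra.frac c j'.succ 0)} ⊔
        Ideal.span {algebraMap _ (X'.presheaf.stalk x')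
          (MvPolynomial.aeval (fun l : Fin r => blowupAlgebra.frac c j'.succ l.succ) Φ)} := by
    rw [stalkIdeal_sup, hSt𝓢, hStK]; rfl
  obtain ⟨hreg, hdim⟩ := hΔ j' 𝔔.asIdeal h𝔔 he₀ hΦ𝔔 (X'.presheaf.stalk x')
  rw [hId]
  exact ⟨hreg, hdim⟩

end Summit.ResolutionOfSingularities.ResolutionOfSingularities.Cruxes.EquisingularLiftNat.Sections

end
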